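import Mathlib
import Summits.Ventures.PercRepro2.Defs
import Summits.Ventures.PercRepro2.Independence
import Summits.Ventures.PercRepro2.Graph
import Summits.Ventures.PercRepro2.Exploration
import Summits.Ventures.PercRepro2.Induced

/-!
# Exploring the edges around a vertex set (blind cell PercRepro2, p1)

The exploration-process toolkit behind van den Berg–Kahn-type arguments, on the induced
percolation of `Induced.lean`:

* `frontier ends U Z ω` — the vertices of `U ∖ Z` joined to `Z` by an open edge of `ω`
  (what exploring the edges around `Z` reveals); it is `∪`-additive and `∩`-subadditive in `ω`
  and determined by the edges touching `Z`;
* the **pointwise domain Markov identity** `QEvent_inter_REvent_union_eq`: for `s ∉ Z`,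
  `Q^U_C ∩ R^U_{W ∪ Z} = {ω | ω ∈ Q^{U∖Z}_C ∩ R^{U∖Z}_{W ∪ frontier ω}}`;
* the **tower identity** `prob_tower` and its instance `prob_QEvent_inter_REvent_union`:
  `P(Q^U_C ∩ R^U_{W∪Z}) = ∑_ω weight p ω · P(Q^{U∖Z}_C ∩ R^{U∖Z}_{W ∪ frontier ω})`.
-/

namespace Summit.Ventures.PercRepro2

/-! ## The frontier of `Z` -/

section Frontier

variable {V : Type*} {E : Type*} [Fintype E] [DecidableEq V] {ends : E → Sym2 V} {U Z : Finset V}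

/-- The frontier is `∪`-additive: `S(ω ⊔ ω') = S(ω) ∪ S(ω')`. -/
lemma frontier_sup (ω ω' : Config E) :
    frontier ends U Z (ω ⊔ ω') = frontier ends U Z ω ∪ frontier ends U Z ω' := by
  ext y
  simp only [mem_frontier, Finset.mem_union, sup_apply_eq_true_iff]
  constructor
  · rintro ⟨hy, e, (he | he), z, hz, hends⟩
    · exact Or.inl ⟨hy, e, he, z, hz, hends⟩
    · exact Or.inr ⟨hy, e, he, z, hz, hends⟩
  · rintro (⟨hy, e, he, z, hz, hends⟩ | ⟨hy, e, he, z, hz, hends⟩)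
    · exact ⟨hy, e, Or.inl he, z, hz, hends⟩
    · exact ⟨hy, e, Or.inr he, z, hz, hends⟩

/-- The frontier is `∩`-subadditive: `S(ω ⊓ ω') ⊆ S(ω) ∩ S(ω')`. -/
lemma frontier_inf_subset (ω ω' : Config E) :
    frontier ends U Z (ω ⊓ ω') ⊆ frontier ends U Z ω ∩ frontier ends U Z ω' := by
  intro y hy
  rw [Finset.mem_inter]
  rw [mem_frontier] at hy ⊢
  obtain ⟨hy, e, he, z, hz, hends⟩ := hy
  rw [inf_apply_eq_true_iff] at he
  exact ⟨⟨hy, e, he.1, z, hz, hends⟩, mem_frontier.2 ⟨hy, e, he.2, z, hz, hends⟩⟩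

/-- The frontier is determined by the edges touching `Z`. -/
lemma dependsOn_frontier (ends : E → Sym2 V) (U Z : Finset V) :
    DependsOn (frontier ends U Z) (touches ends (↑Z)) := by
  intro ω ω' h
  ext y
  simp only [mem_frontier]
  constructor
  · rintro ⟨hy, e, he, z, hz, hends⟩
    refine ⟨hy, e, ?_, z, hz, hends⟩
    rw [← h e ⟨z, hz, y, by rw [hends, Sym2.eq_swap]⟩]
    exact he
  · rintro ⟨hy, e, he, z, hz, hends⟩
    refine ⟨hy, e, ?_, z, hz, hends⟩
    rw [h e ⟨z, hz, y, by rw [hends, Sym2.eq_swap]⟩]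
    exact he

omit [Fintype E] in
/-- The edges touching `Z` and the edges inside `U ∖ Z` are disjoint. -/
lemma disjoint_touches_within_sdiff (ends : E → Sym2 V) (U Z : Finset V) :
    Disjoint (touches ends (↑Z)) (within ends (↑(U \ Z))) := by
  rw [Set.disjoint_left]
  rintro e ⟨z, hz, y, hends⟩ ⟨x', hx', y', hy', hends'⟩
  rw [hends, Sym2.eq_iff] at hends'
  rcases hends' with ⟨rfl, -⟩ | ⟨rfl, -⟩
  · exact (Finset.mem_sdiff.1 (Finset.mem_coe.1 hx')).2 (Finset.mem_coe.1 hz)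
  · exact (Finset.mem_sdiff.1 (Finset.mem_coe.1 hy')).2 (Finset.mem_coe.1 hz)

end Frontier

/-! ## The pointwise domain Markov identity -/

section DMP

variable {V : Type*} {E : Type*} [Fintype E] [DecidableEq V] {ends : E → Sym2 V}

omit [Fintype E] in
/-- On `{s ↮ Z in G[U]}`, connections from `s` in `G[U]` are connections in `G[U ∖ Z]`. -/
lemma conn_induced_sdiff_of_conn {U Z : Finset V} {ω : Config E} {s c : V}
    (hR : ∀ z ∈ Z, ¬ Conn ends (induced ends (↑U) ω) s z)
    (h : Conn ends (induced ends (↑U) ω) s c) :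
    Conn ends (induced ends (↑(U \ Z)) ω) s c := by
  refine mem_of_conn_of_closed (ends := ends) (ω := induced ends (↑U) ω)
    (S := {x | Conn ends (induced ends (↑(U \ Z)) ω) s x}) ?_ (conn_refl _ _ _) h
  intro x hx y hxy
  obtain ⟨_, e, he, hends⟩ := openGraph_adj.1 hxy
  obtain ⟨he', -⟩ := induced_eq_true_iff.1 he
  have hxyU := mem_and_mem_of_induced_eq_true he hends
  have hsx : Conn ends (induced ends (↑U) ω) s x :=
    conn_mono (induced_mono_set (Finset.coe_subset.2 Finset.sdiff_subset) ω) hx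
  have hxZ : x ∉ Z := fun hxZ => hR x hxZ hsx
  have hyZ : y ∉ Z := fun hyZ => hR y hyZ (conn_trans hsx (conn_of_openAdj ⟨e, he, hends⟩))
  have he'' : induced ends (↑(U \ Z)) ω e = true :=
    induced_eq_true_iff.2 ⟨he', x, by simp [hxyU.1, hxZ], y, by simp [hxyU.2, hyZ], hends⟩
  exact conn_trans hx (conn_of_openAdj ⟨e, he'', hends⟩)

/-- If `s ∉ Z` avoids `Z` in `G[U]`, it avoids the frontier of `Z` in `G[U ∖ Z]`. -/
lemma not_conn_frontier_of_not_conn {U Z : Finset V} (hZU : Z ⊆ U) {ω : Config E} {s : V}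
    (hR : ∀ z ∈ Z, ¬ Conn ends (induced ends (↑U) ω) s z) :
    ∀ y ∈ frontier ends U Z ω, ¬ Conn ends (induced ends (↑(U \ Z)) ω) s y := by
  intro y hy hc
  obtain ⟨⟨hyU, _⟩, e, he, z, hz, hends⟩ := mem_frontier.1 hy
  apply hR z hz
  have hsy : Conn ends (induced ends (↑U) ω) s y :=
    conn_mono (induced_mono_set (Finset.coe_subset.2 Finset.sdiff_subset) ω) hc
  refine conn_trans hsy (conn_of_openAdj ⟨e, ?_, hends⟩)
  exact induced_eq_true_iff.2 ⟨he, y, Finset.mem_coe.2 hyU, z, Finset.mem_coe.2 (hZU hz), hends⟩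

/-- If `s ∉ Z` avoids the frontier of `Z` in `G[U ∖ Z]`, it avoids `Z` in `G[U]`. -/
lemma not_conn_of_not_conn_frontier {U Z : Finset V} {ω : Config E} {s : V} (hsZ : s ∉ Z)
    (hF : ∀ y ∈ frontier ends U Z ω, ¬ Conn ends (induced ends (↑(U \ Z)) ω) s y) :
    ∀ z ∈ Z, ¬ Conn ends (induced ends (↑U) ω) s z := by
  intro z hz hc
  have key : z ∈ {x | x ∉ Z ∧ Conn ends (induced ends (↑(U \ Z)) ω) s x} := by
    refine mem_of_conn_of_closed (ends := ends) (ω := induced ends (↑U) ω) ?_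
      ⟨hsZ, conn_refl _ _ _⟩ hc
    rintro x ⟨hxZ, hx⟩ y hxy
    obtain ⟨_, e, he, hends⟩ := openGraph_adj.1 hxy
    obtain ⟨he', -⟩ := induced_eq_true_iff.1 he
    have hxyU := mem_and_mem_of_induced_eq_true he hends
    by_cases hyZ : y ∈ Z
    · exfalso
      exact hF x (mem_frontier.2 ⟨⟨hxyU.1, hxZ⟩, e, he', y, hyZ, hends⟩) hx
    · refine ⟨hyZ, conn_trans hx (conn_of_openAdj ⟨e, ?_, hends⟩)⟩
      exact induced_eq_true_iff.2 ⟨he', x, by simp [hxyU.1, hxZ], y, by simp [hxyU.2, hyZ], hends⟩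
  exact key.1 hz

/-- **Pointwise domain Markov identity** (van den Berg–Kahn (4)): for `s ∉ Z ⊆ U`,
`Q^U_C ∩ R^U_{W ∪ Z} = {ω | ω ∈ Q^{U∖Z}_C ∩ R^{U∖Z}_{W ∪ frontier ω}}`. -/
theorem QEvent_inter_REvent_union_eq {U Z : Finset V} (hZU : Z ⊆ U) {s : V} (hsZ : s ∉ Z)
    (C W : Finset V) :
    QEvent ends U s C ∩ REvent ends U s (W ∪ Z) =
      {ω | ω ∈ QEvent ends (U \ Z) s C ∩ REvent ends (U \ Z) s (W ∪ frontier ends U Z ω)} := by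
  ext ω
  simp only [Set.mem_inter_iff, Set.mem_setOf_eq, mem_QEvent, mem_REvent,
    Finset.forall_mem_union]
  have hmono : ∀ {x : V}, Conn ends (induced ends (↑(U \ Z)) ω) s x →
      Conn ends (induced ends (↑U) ω) s x :=
    fun hc => conn_mono (induced_mono_set (Finset.coe_subset.2 Finset.sdiff_subset) ω) hc
  constructor
  · rintro ⟨hQ, hW, hZ⟩
    exact ⟨fun c hc => conn_induced_sdiff_of_conn hZ (hQ c hc),
      fun w hw hcw => hW w hw (hmono hcw), not_conn_frontier_of_not_conn hZU hZ⟩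
  · rintro ⟨hQ, hW, hF⟩
    have hZ := not_conn_of_not_conn_frontier hsZ hF
    exact ⟨fun c hc => hmono (hQ c hc), fun w hw hcw => hW w hw (conn_induced_sdiff_of_conn hZ hcw),
      hZ⟩

end DMP

/-! ## The tower identity -/

section Tower

/-- Intersections of two events determined by the same edge set are determined by it. -/
lemma dependsOn_inter_same {E : Type*} {A B : Set (Config E)} {F : Set E}
    (hA : DependsOn (· ∈ A) F) (hB : DependsOn (· ∈ B) F) : DependsOn (· ∈ A ∩ B) F := by
  have := dependsOn_inter hA hB
  rwa [Set.union_self] at this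

variable {V : Type*} {E : Type*} [Fintype E] [DecidableEq E] [Fintype V] [DecidableEq V]
  {R : Type*} [CommRing R]

/-- **Tower identity**: if the `Finset`-valued statistic `S` is determined by the edges of `F₁`
and every event `Φ T` by the edges of `F₂`, with `F₁`, `F₂` disjoint, then
`P{ω | ω ∈ Φ (S ω)} = ∑_ω weight p ω · P(Φ (S ω))`. -/
theorem prob_tower (p : E → R) {F₁ F₂ : Set E} (hF : Disjoint F₁ F₂)
    {S : Config E → Finset V} (hS : DependsOn S F₁) {Φ : Finset V → Set (Config E)}
    (hΦ : ∀ T, DependsOn (· ∈ Φ T) F₂) :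
    prob p {ω | ω ∈ Φ (S ω)} = ∑ ω, weight p ω * prob p (Φ (S ω)) := by
  classical
  have h1 : prob p {ω | ω ∈ Φ (S ω)} = ∑ T : Finset V, prob p ({ω | S ω = T} ∩ Φ T) := by
    unfold prob
    rw [← Finset.sum_fiberwise_of_maps_to (s := Finset.univ) (t := Finset.univ) (g := S)
      (fun _ _ => Finset.mem_univ _)]
    refine Finset.sum_congr rfl fun T _ => ?_
    rw [Finset.sum_filter]
    refine Finset.sum_congr rfl fun ω _ => ?_
    by_cases hT : S ω = T
    · rw [if_pos hT]
      have hmem : ω ∈ {ω | ω ∈ Φ (S ω)} ↔ ω ∈ {ω | S ω = T} ∩ Φ T := by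
        simp only [Set.mem_setOf_eq, Set.mem_inter_iff, hT, true_and]
      by_cases hω : ω ∈ {ω | S ω = T} ∩ Φ T
      · rw [Set.indicator_of_mem (hmem.2 hω), Set.indicator_of_mem hω]
      · rw [Set.indicator_of_notMem (fun h => hω (hmem.1 h)), Set.indicator_of_notMem hω]
    · rw [if_neg hT, Set.indicator_of_notMem (show ω ∉ {ω | S ω = T} ∩ Φ T from fun h => hT h.1)]
  have h2 : ∀ T : Finset V, prob p ({ω | S ω = T} ∩ Φ T) = prob p {ω | S ω = T} * prob p (Φ T) :=
    fun T => prob_inter_eq_mul_of_dependsOn p hF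
      (fun ω ω' h => by show (S ω = T) = (S ω' = T); rw [hS h]) (hΦ T)
  rw [h1]
  simp_rw [h2]
  rw [← Finset.sum_fiberwise_of_maps_to (s := Finset.univ) (t := Finset.univ) (g := S)
    (fun _ _ => Finset.mem_univ _) (fun ω => weight p ω * prob p (Φ (S ω)))]
  refine Finset.sum_congr rfl fun T _ => ?_
  rw [prob_eq_sum_filter p {ω | S ω = T}, Finset.sum_mul]
  refine Finset.sum_congr ?_ fun ω hω => ?_
  · ext ω; simp
  · rw [(Finset.mem_filter.1 hω).2]

/-- **Domain Markov identity in probability** (van den Berg–Kahn (4), summed over the values of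
the frontier): for `s ∉ Z ⊆ U`,
`P(Q^U_C ∩ R^U_{W ∪ Z}) = ∑_ω weight p ω · P(Q^{U∖Z}_C ∩ R^{U∖Z}_{W ∪ frontier ω})`. -/
theorem prob_QEvent_inter_REvent_union (p : E → R) (ends : E → Sym2 V) {U Z : Finset V}
    (hZU : Z ⊆ U) {s : V} (hsZ : s ∉ Z) (C W : Finset V) :
    prob p (QEvent ends U s C ∩ REvent ends U s (W ∪ Z)) =
      ∑ ω, weight p ω *
        prob p (QEvent ends (U \ Z) s C ∩ REvent ends (U \ Z) s (W ∪ frontier ends U Z ω)) := by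
  rw [QEvent_inter_REvent_union_eq hZU hsZ C W]
  exact prob_tower p (disjoint_touches_within_sdiff ends U Z) (dependsOn_frontier ends U Z)
    fun T => dependsOn_inter_same (dependsOn_QEvent ends (U \ Z) s C)
      (dependsOn_REvent ends (U \ Z) s (W ∪ T))

end Tower

end Summit.Ventures.PercRepro2
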